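import Summits.ValiantsHypothesis.ValiantsHypothesis.Theorems.DivisionGapDefs

/-!
# Crux `DivisionGap.PerDivisionHard` (stmt-ValiantsHypothesis-5065), line
`pair-descent-jss-endpoint` — stub `stub_fibreArith` (level matching across scales)

The descent across scales projects the degenerate pair from size `n` to a block of size `b` with
`n ≤ b ^ a` and re-applies the landed rungs there; their thresholds are quasi-polynomial
`2^{(log₂ b + c₁)^{c₁}}` while the crux's is `2^{(log₂ n + c)^c}`.  The composition needs the
purely arithmetic level-matching lemma

* `stub_fibreArith` — for all `a c` there is `c₁` (namely `c₁ = 2a + 2c + 2`) with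
  `(log₂ n + c)^c ≤ (log₂ b + c₁)^{c₁}` whenever `n ≤ b ^ a`.

Proof: `b < 2^(log₂ b + 1)` gives `n ≤ b^a ≤ 2^{a (log₂ b + 1)}`, so `log₂ n ≤ a (log₂ b + 1)`
(`Nat.log` is monotone, `Nat.log_pow`); then `log₂ n + c ≤ (log₂ b + c₁)²` and
`((log₂ b + c₁)²)^c = (log₂ b + c₁)^{2c} ≤ (log₂ b + c₁)^{c₁}` as `2c ≤ c₁` and `1 ≤ c₁`.
-/

noncomputable section

-- `Summit.ValiantsHypothesis.ValiantsHypothesis.…` is the tree's mandated single-conjunct layout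
-- (Sub = Summit), so the duplicated namespace component is intended.
set_option linter.dupNamespace false

namespace Summit.ValiantsHypothesis.ValiantsHypothesis.Theorems.DivisionGapPerDivisionHard

/-- `n ≤ b ^ a` forces `log₂ n ≤ a (log₂ b + 1)`. [folklore] -/
theorem log_two_le_of_le_pow (a n b : ℕ) (hnb : n ≤ b ^ a) :
    Nat.log 2 n ≤ a * (Nat.log 2 b + 1) := by
  have hb : b < 2 ^ (Nat.log 2 b + 1) := Nat.lt_pow_succ_log_self one_lt_two b
  have h1 : n ≤ 2 ^ ((Nat.log 2 b + 1) * a) :=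
    calc n ≤ b ^ a := hnb
      _ ≤ (2 ^ (Nat.log 2 b + 1)) ^ a := Nat.pow_le_pow_left hb.le a
      _ = 2 ^ ((Nat.log 2 b + 1) * a) := by rw [← pow_mul]
  calc Nat.log 2 n ≤ Nat.log 2 (2 ^ ((Nat.log 2 b + 1) * a)) := Nat.log_mono_right h1
    _ = (Nat.log 2 b + 1) * a := Nat.log_pow one_lt_two _
    _ = a * (Nat.log 2 b + 1) := mul_comm _ _

/-- The base comparison: `a (x + 1) + c ≤ (x + (2a + 2c + 2))²`. [folklore] -/
theorem fibreArith_base_le (a c x : ℕ) :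
    a * (x + 1) + c ≤ (x + (2 * a + 2 * c + 2)) ^ 2 := by
  nlinarith [Nat.zero_le (a * x), Nat.zero_le (c * x), Nat.zero_le (x * x), Nat.zero_le (a * a),
    Nat.zero_le (a * c), Nat.zero_le (c * c)]

/-- **stub_fibreArith — level matching across scales.**  If `n ≤ b^a` then
`log₂ n ≤ a (log₂ b + 1)`, so `(log₂ n + c)^c ≤ (log₂ b + c₁)^{c₁}` for some `c₁ = c₁(a, c)`
(here `c₁ = 2a + 2c + 2`; `a = 0` forces `n ≤ 1`). [folklore] -/
theorem stub_fibreArith :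
    ∀ a c : ℕ, ∃ c₁ : ℕ, ∀ n b : ℕ, n ≤ b ^ a →
      (Nat.log 2 n + c) ^ c ≤ (Nat.log 2 b + c₁) ^ c₁ := by
  intro a c
  refine ⟨2 * a + 2 * c + 2, fun n b hnb => ?_⟩
  have hbase : Nat.log 2 n + c ≤ (Nat.log 2 b + (2 * a + 2 * c + 2)) ^ 2 :=
    (Nat.add_le_add_right (log_two_le_of_le_pow a n b hnb) c).trans
      (fibreArith_base_le a c (Nat.log 2 b))
  calc (Nat.log 2 n + c) ^ c ≤ ((Nat.log 2 b + (2 * a + 2 * c + 2)) ^ 2) ^ c :=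
        Nat.pow_le_pow_left hbase c
    _ = (Nat.log 2 b + (2 * a + 2 * c + 2)) ^ (2 * c) := by rw [← pow_mul]
    _ ≤ (Nat.log 2 b + (2 * a + 2 * c + 2)) ^ (2 * a + 2 * c + 2) :=
        Nat.pow_le_pow_right (by omega) (by omega)

end Summit.ValiantsHypothesis.ValiantsHypothesis.Theorems.DivisionGapPerDivisionHard

end
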